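import Literature.Geometry.Kaehler.ComplexTorusIntegralHodgeLatticeThetaDegrees
import Literature.Geometry.Kaehler.ComplexTorusBeauvilleFourierAnyBasis
import Literature.Geometry.Kaehler.ComplexTorusFourierParsevalAllDegrees
import Literature.Geometry.Kaehler.ComplexTorusDualPolarizationType
import Literature.Geometry.Kaehler.ComplexTorusTranscendentalLatticeInvariance
import HarnessLib

/-!
# The Fourier duality of the `θ`-degree generators: `k!·⟨θ^{∧l}, z⟩_X = (−1)^k·l!·d·⟨(E^*)^{∧k}, F z⟩_X̂`,
# `δ_k(X, E)·k!·(d₁d_g)^k = δ_l(X̂, E_δ)·l!·d₁⋯d_g`, `δ_l·l! ∣ δ_k·k!·d₁⋯d_g`, and `δ_k·k! = δ_{g−k}·(g−k)!` on a principally polarised torus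

Layer `Literature/Geometry/Kaehler`, namespace `Literature.Geometry.Kaehler.ComplexTorus`; lane `lit-hodgefound`
(Track 2 foundations library), seat p09, generation 50, row g50-#1. THEOREMS ONLY (0 definitions); no named fact, net debt 0.

g49-#11 (`ComplexTorusIntegralHodgeLatticeThetaDegrees`) introduced, without a definition, the positive generator `δ_k` of the group of
`θ`-DEGREES `{⟨θ^{∧l}, z⟩_e : z ∈ Hdgᵏ(X, ℤ)} = δ_k·ℤ` (`k + l = g`) of a complex torus `X = E/Φ(ℤ^ι)` polarised by a Riemann form
`η = E` of type `(d₁, …, d_g)` (`θ = ofRealForm η`; «`δ` divides every degree and is a degree»), with `(l!·d₁⋯d_l) ∣ δ_k`,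
`δ_k·(k!·d₁⋯d_k) ∣ g!·d₁⋯d_g`, `δ_{k+1} ∣ δ_k`, and the lower-half formula `δ_p = ((g−p)!·d₁⋯d_{g−p})·n_p` through the Lefschetz form.
This file relates the generators in COMPLEMENTARY codimensions `k` and `l = g − k` through the cohomological Fourier(–Mukai) transform
`F : H^{2k}(X) → H^{2l}(X̂)` of Lange 2023 §6.2.4 (the tree's `fourierForm`, prover p08), which the tree already knows to be an
integral isomorphism `Hdgᵏ(X, ℤ) ⥲ Hdg^l(X̂, ℤ)` (g31-#9 `ComplexTorusFourierIntegralHodgeLattices`, Prop. 6.2.20/6.2.21), an isometry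
up to sign for the cup-product pairings (g32-#1 `ComplexTorusFourierParsevalAllDegrees`: `⟨F x, F y⟩^X̂ = (−1)^{g+pm}⟨x, y⟩^X`), and to
map `θ^{∧l}` to `(−1)^l (l!·d/k!)·(E^*)^{∧k}` (Beauville's formula, Lange Thm. 6.3.5 / (6.12), the tree's
`IsPolarizationType.fourierForm_wedgePow_chernClass_div_factorial` of `ComplexTorusBeauvilleFourierAnyBasis`; `d = d₁⋯d_g`, `E^* = dualForm`
Lang's transport of `E` to `X̂`, `E_δ = d₁d_g·E^*` the dual polarisation of Lange Prop. 2.5.1, of type `(d₁d_g/d_g, …, d₁d_g/d₁)`, the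
tree's `IsPolarizationType.dual` / `IsRiemannForm.dualPolarization`):

* §1 **THE TRANSPORT IDENTITY `k!·⟨θ^{∧l}, z⟩^X_e = (−1)^k·l!·(d₁⋯d_g)·⟨(E^*)^{∧k}, F z⟩^X̂_e`** for every `z ∈ H^{2k}(X, ℂ)`, `k + l = g`,
  on ANY presentation (`IsPolarizationType.factorial_mul_poincarePairing_wedgePow_eq_fourier`): Parseval + Beauville.
* §2 **`δ_k(X, E)·k!·(d₁d_g)^k = δ_l(X̂, E_δ)·l!·d₁⋯d_g`** (`IsPolarizationType.thetaDegree_generator_mul_eq_dual`): `F` maps `Hdgᵏ(X, ℤ)`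
  ONTO `Hdg^l(X̂, ℤ)` and `E_δ^{∧k} = (d₁d_g)^k (E^*)^{∧k}`, so the two degree groups are proportional with the factor of §1; data-free form
  `IsPolarizationType.exists_thetaDegree_generator_dual` (both generators exist, by g49-#11 on `X` and on the polarised dual torus).
* §3 **BACK TO `X` ALONG `φ_L`**: for every `z ∈ Hdgᵏ(X, ℤ)` the class `w = φ_L^*(F z) ∈ Hdg^l(X, ℤ)` (`φ_L = ρ(ᵗG)`, `G` the integer
  Gram matrix, `φ_L^*(E^*)^{∧k} = E^{∧k}`, `⟨φ_L^*a, φ_L^*b⟩^X = deg φ_L·⟨a, b⟩^X̂ = d²·⟨a, b⟩^X̂`) has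
  **`l!·⟨θ^{∧k}, w⟩^X_e = (−1)^k·k!·(d₁⋯d_g)·⟨θ^{∧l}, z⟩^X_e`** (`IsPolarizationType.exists_mem_integralHodgeClassesIn_factorial_mul_poincarePairing_eq`);
  hence **`δ_l·l! ∣ δ_k·k!·d₁⋯d_g`** for all `k + l = g` (`IsPolarizationType.thetaDegree_generator_mul_factorial_dvd`) and, for a
  PRINCIPAL polarisation, **`δ_k·k! = δ_l·l!`** (`IsPolarizationType.thetaDegree_generator_mul_factorial_eq_of_type_one`): the least
  `θ`-degrees of integral Hodge classes in complementary codimensions determine each other — e.g. `δ_1 = (g−1)!·δ_{g−1}`: the least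
  `θ^{g−1}`-degree of a divisor class is `(g−1)!` times the least `θ`-degree of an integral Hodge curve class
  (`IsPolarizationType.thetaDegree_generator_one_eq_factorial_mul_of_type_one`).

What is formalised is OUR ROAD (the printed sources give the ingredients — Prop. 6.2.20/6.2.21, Parseval as «`F` is Poincaré duality up to
sign», Thm. 6.3.5, Prop. 2.5.1, Prop. 2.4.12 (b) — not these corollaries about degree groups).

## Contents (theorems only; no definition, no named fact)

* §1 `IsPolarizationType.factorial_smul_fourierForm_wedgePow` (`k!·F(θ^{∧l}) = (−1)^l·l!·d·(E^*)^{∧k}`),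
  **`IsPolarizationType.factorial_mul_poincarePairing_wedgePow_eq_fourier`**.
* §2 **`IsPolarizationType.thetaDegree_generator_mul_eq_dual`**, `IsPolarizationType.exists_thetaDegree_generator_dual`.
* §3 `IsPolarizationType.poincarePairing_comp_realRep_transposeGram` (`⟨φ_L^*a, φ_L^*b⟩^X = d²·⟨a, b⟩^X̂`),
  **`IsPolarizationType.exists_mem_integralHodgeClassesIn_factorial_mul_poincarePairing_eq`**,
  **`IsPolarizationType.thetaDegree_generator_mul_factorial_dvd`**, **`IsPolarizationType.thetaDegree_generator_mul_factorial_eq_of_type_one`**,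
  `IsPolarizationType.thetaDegree_generator_one_eq_factorial_mul_of_type_one`, `IsPolarizationType.exists_thetaDegree_generator_mul_factorial_eq_of_type_one`,
  `IsPrincipalPolarization.thetaDegree_generator_mul_factorial_eq`.

## References

* [cite: Lange2023AbelianVarietiesComplex, §6.2.4 Prop. 6.2.20, Prop. 6.2.21 (pp. 310–311); §6.3.2 Thm. 6.3.5 with (6.12) (pp. 315–316); §2.5.1 Prop. 2.5.1 (p. 131); §2.4.3 Prop. 2.4.12 (b); §1.4.2 Lemma 1.4.5, Prop. 1.4.7]
* [cite: Beauville1983FourierChow, §3 Prop. 5 (p. 248)]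
* [cite: Mukai1981, §2 Thm. 2.2 (pp. 155–157)]
* [cite: Lang1982AbelianFunctions, Ch. VII §5 Thm. 5.2 (pp. 119–120)]
* [cite: BenoistDebarre2023SmoothSubvarietiesJacobians, §1 (p. 3); §3 Prop. 3.3]
-/

noncomputable section

-- `Module ℂ` / `SMulZeroClass ℂ` synthesis on `E [⋀^Fin k]→L[ℝ] ℂ` (as in `ComplexTorusLefschetzDecomposition`)
set_option maxSynthPendingDepth 3

open Module Function Complex
open LinearMap (BilinForm)
open Literature.LinearAlgebra.Alternating

namespace Literature.Geometry.Kaehler.ComplexTorus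

universe uE

/-! ## §0 Arithmetic helpers -/

section Generic

/-- `(−1)^m·(−1)^m = 1`. [folklore] -/
private theorem neg_one_pow_mul_self₁₀₃ (m : ℕ) : ((-1 : ℂ) ^ m) * (-1) ^ m = 1 := by
  rw [← pow_add, ← two_mul, pow_mul, neg_one_sq, one_pow]

end Generic

/-! ## §1 The transport identity `k!·⟨θ^{∧l}, z⟩^X = (−1)^k·l!·d·⟨(E^*)^{∧k}, F z⟩^X̂` -/

section Transport

variable {ι : Type*} [Fintype ι] [LinearOrder ι] {E : Type uE} [NormedAddCommGroup E] [NormedSpace ℂ E]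
  (Φ : (ι → ℝ) ≃L[ℝ] E) {j n k l : ℕ} {η : E [⋀^Fin 2]→L[ℝ] ℝ} {d : Fin (j + 2) → ℕ}

/-- **Beauville's formula without inverses: `k!·F(θ^{∧l}) = (−1)^l·l!·(d₁⋯d_g)·(E^*)^{∧k}`** (`k + l = g`, `θ = E`, `E^* = dualForm`), for
every presentation and every enumeration (from the tree's `(l!)⁻¹ F((−θ)^{∧l}) = d·(k!)⁻¹ (E^*)^{∧k}`).
[cite: Lange2023AbelianVarietiesComplex, §6.3.2 Thm. 6.3.5 with (6.12) (pp. 315–316)] [cite: Beauville1983FourierChow, §3 Prop. 5 (p. 248)] -/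
theorem IsPolarizationType.factorial_smul_fourierForm_wedgePow (hd : IsPolarizationType Φ η d) (hη : IsRiemannForm Φ η)
    (hkl : k + l = j + 2) (e : Fin n ≃ ι) (hn : 2 * l + 2 * k = n) :
    (k.factorial : ℂ) • fourierForm Φ e hn (wedgePow (ofRealForm η) l) =
      ((-1 : ℂ) ^ l * l.factorial * ∏ i, (d i : ℂ)) • wedgePow (ofRealForm (dualForm Φ hη.1 hη.nondegenerate)) k := by
  have hkf : (k.factorial : ℂ) ≠ 0 := by exact_mod_cast (Nat.factorial_pos _).ne'
  have hlf : (l.factorial : ℂ) ≠ 0 := by exact_mod_cast (Nat.factorial_pos _).ne'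
  have h := hd.fourierForm_wedgePow_chernClass_div_factorial Φ hη (show k + l = j + 1 + 1 by omega) ((finCongr hn).trans e)
  rw [wedgePow_neg, fourierForm_smul, ← fourierForm_eq_fourierForm_of_eq Φ e ((finCongr hn).trans e) hn rfl, smul_smul] at h
  have h2 := congrArg (fun w ↦ ((k.factorial : ℂ) * l.factorial * (-1) ^ l) • w) h
  simp only [smul_smul] at h2
  have hc₁ : (k.factorial : ℂ) * l.factorial * (-1) ^ l * (((l.factorial : ℂ))⁻¹ * (-1) ^ l) = k.factorial := by
    calc _ = (k.factorial : ℂ) * (l.factorial * ((l.factorial : ℂ))⁻¹) * ((-1) ^ l * (-1) ^ l) := by ring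
      _ = k.factorial := by rw [mul_inv_cancel₀ hlf, neg_one_pow_mul_self₁₀₃, mul_one, mul_one]
  have hc₂ : (k.factorial : ℂ) * l.factorial * (-1) ^ l * ((∏ i, (d i : ℂ)) * ((k.factorial : ℂ))⁻¹) =
      (-1) ^ l * l.factorial * ∏ i, (d i : ℂ) := by
    calc _ = (k.factorial * ((k.factorial : ℂ))⁻¹) * ((-1) ^ l * l.factorial * ∏ i, (d i : ℂ)) := by ring
      _ = _ := by rw [mul_inv_cancel₀ hkf, one_mul]
  rw [hc₁, hc₂] at h2
  exact h2

/-- **THE TRANSPORT IDENTITY `k!·⟨θ^{∧l}, z⟩^X_e = (−1)^k·l!·(d₁⋯d_g)·⟨(E^*)^{∧k}, F z⟩^X̂_e`** for every `z ∈ H^{2k}(X, ℂ)` and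
`k + l = g`: Parseval `⟨F θ^{∧l}, F z⟩^X̂ = (−1)^g ⟨θ^{∧l}, z⟩^X` (Prop. 6.2.20: `F` is Poincaré duality up to sign) and Beauville's
`F(θ^{∧l}) = (−1)^l (l!·d/k!)·(E^*)^{∧k}` (Thm. 6.3.5). The `θ`-degrees on `X` against `θ^{∧l}` and the `E^*`-degrees on `X̂` against
`(E^*)^{∧k}` correspond under `F` by the factor `l!·d/k!`.
[cite: Lange2023AbelianVarietiesComplex, §6.2.4 Prop. 6.2.20 (pp. 310–311); §6.3.2 Thm. 6.3.5 with (6.12) (pp. 315–316)] [cite: Beauville1983FourierChow, §3 Prop. 5 (p. 248)] [cite: Mukai1981, §2 Thm. 2.2] -/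
theorem IsPolarizationType.factorial_mul_poincarePairing_wedgePow_eq_fourier (hd : IsPolarizationType Φ η d) (hη : IsRiemannForm Φ η)
    (hkl : k + l = j + 2) (e : Fin n ≃ ι) (hn : 2 * l + 2 * k = n) (hn' : 2 * k + 2 * l = n) (z : E [⋀^Fin (2 * k)]→L[ℝ] ℂ) :
    (k.factorial : ℂ) * poincarePairing Φ e hn (wedgePow (ofRealForm η) l) z =
      (-1) ^ k * l.factorial * (∏ i, (d i : ℂ)) *
        poincarePairing (dualPeriod Φ) e hn' (wedgePow (ofRealForm (dualForm Φ hη.1 hη.nondegenerate)) k) (fourierForm Φ e hn' z) := by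
  set P := poincarePairing Φ e hn (wedgePow (ofRealForm η) l) z with hPdef
  set Q := poincarePairing (dualPeriod Φ) e hn' (wedgePow (ofRealForm (dualForm Φ hη.1 hη.nondegenerate)) k)
    (fourierForm Φ e hn' z) with hQdef
  have hP := poincarePairing_fourierForm_fourierForm_of_add Φ e hn hn' (wedgePow (ofRealForm η) l) z
  have hB := hd.factorial_smul_fourierForm_wedgePow Φ hη hkl e hn
  -- `k!·⟨F θ^{∧l}, F z⟩ = ((−1)^l l! d)·⟨(E^*)^{∧k}, F z⟩`
  have h1 := congrArg (fun w ↦ poincarePairing (dualPeriod Φ) e hn' w (fourierForm Φ e hn' z)) hB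
  simp only [map_smul, LinearMap.smul_apply, smul_eq_mul] at h1
  rw [hP, ← hPdef, ← hQdef] at h1
  have hfr : finrank ℂ E = k + l := finrank_eq_add_of_equiv Φ ((finCongr hn).trans e)
  have hsign : (-1 : ℂ) ^ (finrank ℂ E + 2 * l * (2 * k)) = (-1) ^ k * (-1) ^ l := by
    rw [hfr, pow_add, pow_add, show 2 * l * (2 * k) = 2 * (2 * l * k) by ring, pow_mul, neg_one_sq, one_pow, mul_one]
  rw [hsign] at h1
  have hu := neg_one_pow_mul_self₁₀₃ k
  have hv := neg_one_pow_mul_self₁₀₃ l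
  linear_combination ((-1 : ℂ) ^ k * (-1) ^ l) * h1 + (-(k.factorial : ℂ) * P * ((-1) ^ l * (-1) ^ l)) * hu +
    (-(k.factorial : ℂ) * P + (-1) ^ k * l.factorial * (∏ i, (d i : ℂ)) * Q) * hv

end Transport

/-! ## §2 `δ_k(X, E)·k!·(d₁d_g)^k = δ_l(X̂, E_δ)·l!·d₁⋯d_g` -/

section Dual

variable {ι : Type*} [Fintype ι] [LinearOrder ι] {E : Type uE} [NormedAddCommGroup E] [NormedSpace ℂ E]
  (Φ : (ι → ℝ) ≃L[ℝ] E) {j n k l : ℕ} {η : E [⋀^Fin 2]→L[ℝ] ℝ} (d : Fin (j + 2) → ℕ)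

/-- `E_δ^{∧k} = (d₁d_g)^k·(E^*)^{∧k}` for the dual polarisation `E_δ = d₁d_g·E^*`. [cite: Lange2023AbelianVarietiesComplex, §2.5.1 Prop. 2.5.1 (p. 131)] -/
private theorem wedgePow_ofRealForm_dualPolarization₁₀₃ (hη : IsRiemannForm Φ η) (k : ℕ) :
    wedgePow (ofRealForm (((d 0 * d (Fin.last (j + 1)) : ℕ) : ℝ) • dualForm Φ hη.1 hη.nondegenerate)) k =
      ((d 0 * d (Fin.last (j + 1)) : ℕ) : ℂ) ^ k • wedgePow (ofRealForm (dualForm Φ hη.1 hη.nondegenerate)) k := by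
  rw [ofRealForm_smul, wedgePow_smul, Complex.ofReal_natCast]

/-- From `(a : ℤ) ∣ c` and `X·c = ±Y` conclude `X·a ∣ Y` (naturals). [folklore] -/
private theorem mul_dvd_of_mul_eq_neg_one_pow_mul₁₀₃ {X a Y : ℕ} {c : ℤ} (m : ℕ) (hac : (a : ℤ) ∣ c)
    (h : (X : ℤ) * c = (-1) ^ m * (Y : ℤ)) : X * a ∣ Y := by
  have h1 : ((X * a : ℕ) : ℤ) ∣ (X : ℤ) * c := by
    rw [Nat.cast_mul]
    exact mul_dvd_mul_left _ hac
  rw [h, (isUnit_neg_one.pow m).dvd_mul_left] at h1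
  exact Int.natCast_dvd_natCast.1 h1

variable {d}

/-- **`δ_k(X, E)·k!·(d₁d_g)^k = δ_l(X̂, E_δ)·l!·d₁⋯d_g`** (`k + l = g`): if `δ` generates the `θ`-degrees `⟨θ^{∧l}, z⟩` of `Hdgᵏ(X, ℤ)` and `δ'`
generates the `E_δ`-degrees `⟨E_δ^{∧k}, w⟩` of `Hdg^l(X̂, ℤ)` (`E_δ = d₁d_g·E^*` the dual polarisation of `X̂`, Prop. 2.5.1), then
`δ·k!·(d₁d_g)^k = δ'·l!·d₁⋯d_g` — the Fourier transform maps `Hdgᵏ(X, ℤ)` ONTO `Hdg^l(X̂, ℤ)` (Prop. 6.2.20/6.2.21) and transports the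
degrees by §1. Principal: `δ_k(X)·k! = δ_l(X̂)·l!`.
[cite: Lange2023AbelianVarietiesComplex, §6.2.4 Prop. 6.2.20, Prop. 6.2.21 (pp. 310–311); §6.3.2 Thm. 6.3.5 (p. 315); §2.5.1 Prop. 2.5.1 (p. 131)] [cite: Beauville1983FourierChow, §3 Prop. 5 (p. 248)] -/
theorem IsPolarizationType.thetaDegree_generator_mul_eq_dual (hd : IsPolarizationType Φ η d) (hη : IsRiemannForm Φ η)
    (hkl : k + l = j + 2) (e : Fin n ≃ ι) (hn : 2 * l + 2 * k = n) (hn' : 2 * k + 2 * l = n) {δ δ' : ℕ}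
    (hδ : (∀ z ∈ integralHodgeClassesIn Φ (2 * k) k, ∃ c : ℤ, poincarePairing Φ e hn (wedgePow (ofRealForm η) l) z = c ∧ (δ : ℤ) ∣ c) ∧
      ∃ z ∈ integralHodgeClassesIn Φ (2 * k) k, poincarePairing Φ e hn (wedgePow (ofRealForm η) l) z = (δ : ℂ))
    (hδ' : (∀ w ∈ integralHodgeClassesIn (dualPeriod Φ) (2 * l) l, ∃ c : ℤ,
        poincarePairing (dualPeriod Φ) e hn'
          (wedgePow (ofRealForm (((d 0 * d (Fin.last (j + 1)) : ℕ) : ℝ) • dualForm Φ hη.1 hη.nondegenerate)) k) w = c ∧ (δ' : ℤ) ∣ c) ∧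
      ∃ w ∈ integralHodgeClassesIn (dualPeriod Φ) (2 * l) l,
        poincarePairing (dualPeriod Φ) e hn'
          (wedgePow (ofRealForm (((d 0 * d (Fin.last (j + 1)) : ℕ) : ℝ) • dualForm Φ hη.1 hη.nondegenerate)) k) w = (δ' : ℂ)) :
    δ * (k.factorial * (d 0 * d (Fin.last (j + 1))) ^ k) = δ' * (l.factorial * ∏ i, d i) := by
  -- the transport identity for `E_δ^{∧k} = (d₁d_g)^k (E^*)^{∧k}`
  have key : ∀ z : E [⋀^Fin (2 * k)]→L[ℝ] ℂ,
      (((k.factorial * (d 0 * d (Fin.last (j + 1))) ^ k : ℕ) : ℤ) : ℂ) * poincarePairing Φ e hn (wedgePow (ofRealForm η) l) z =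
        (-1) ^ k * (((l.factorial * ∏ i, d i : ℕ) : ℤ) : ℂ) *
          poincarePairing (dualPeriod Φ) e hn'
            (wedgePow (ofRealForm (((d 0 * d (Fin.last (j + 1)) : ℕ) : ℝ) • dualForm Φ hη.1 hη.nondegenerate)) k)
            (fourierForm Φ e hn' z) := fun z ↦ by
    rw [wedgePow_ofRealForm_dualPolarization₁₀₃ Φ d hη k, map_smul, LinearMap.smul_apply, smul_eq_mul]
    have h := hd.factorial_mul_poincarePairing_wedgePow_eq_fourier Φ hη hkl e hn hn' z
    push_cast
    linear_combination ((d 0 : ℂ) * (d (Fin.last (j + 1)) : ℂ)) ^ k * h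
  -- (i) `k!·(d₁d_g)^k·δ ∣ l!·d·δ'`: a class attaining `δ'` is `F z₀` with `z₀ ∈ Hdgᵏ(X, ℤ)`
  have h₁ : k.factorial * (d 0 * d (Fin.last (j + 1))) ^ k * δ ∣ l.factorial * (∏ i, d i) * δ' := by
    obtain ⟨w₀, hw₀, hw₀δ⟩ := hδ'.2
    obtain ⟨z₀, hz₀, hFz₀⟩ := exists_mem_integralHodgeClasses_fourierForm_eq Φ ((finCongr hn').trans e)
      (show w₀ ∈ integralHodgeClasses (dualPeriod Φ) l from hw₀)
    rw [← fourierForm_eq_fourierForm_of_eq Φ e ((finCongr hn').trans e) hn' rfl] at hFz₀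
    obtain ⟨c₀, hc₀, hδc₀⟩ := hδ.1 z₀ hz₀
    have hk := key z₀
    rw [hFz₀, hw₀δ, hc₀] at hk
    have hZ : (((k.factorial * (d 0 * d (Fin.last (j + 1))) ^ k : ℕ) : ℤ)) * c₀ =
        (-1) ^ k * (((l.factorial * ∏ i, d i) * δ' : ℕ) : ℤ) := by
      apply Int.cast_injective (α := ℂ)
      push_cast at hk ⊢
      linear_combination hk
    exact mul_dvd_of_mul_eq_neg_one_pow_mul₁₀₃ k hδc₀ hZ
  -- (ii) `l!·d·δ' ∣ k!·(d₁d_g)^k·δ`: `F z₁ ∈ Hdg^l(X̂, ℤ)` for a class `z₁` attaining `δ`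
  have h₂ : l.factorial * (∏ i, d i) * δ' ∣ k.factorial * (d 0 * d (Fin.last (j + 1))) ^ k * δ := by
    obtain ⟨z₁, hz₁, hz₁δ⟩ := hδ.2
    have hF : fourierForm Φ e hn' z₁ ∈ integralHodgeClassesIn (dualPeriod Φ) (2 * l) l := by
      rw [fourierForm_eq_fourierForm_of_eq Φ e ((finCongr hn').trans e) hn' rfl]
      exact fourierForm_mem_integralHodgeClasses Φ ((finCongr hn').trans e) hz₁
    obtain ⟨c₁, hc₁, hδc₁⟩ := hδ'.1 _ hF
    have hk := key z₁
    rw [hz₁δ, hc₁] at hk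
    have hZ : (((l.factorial * ∏ i, d i : ℕ) : ℤ)) * c₁ =
        (-1) ^ k * (((k.factorial * (d 0 * d (Fin.last (j + 1))) ^ k) * δ : ℕ) : ℤ) := by
      apply Int.cast_injective (α := ℂ)
      push_cast at hk ⊢
      linear_combination (-(-1 : ℂ) ^ k) * hk +
        (-((l.factorial : ℂ) * (∏ i, (d i : ℂ)) * c₁)) * neg_one_pow_mul_self₁₀₃ k
    exact mul_dvd_of_mul_eq_neg_one_pow_mul₁₀₃ k hδc₁ hZ
  rw [mul_comm δ, mul_comm δ']
  exact Nat.dvd_antisymm h₁ h₂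

/-- **Both generators exist, with `δ_k(X, E)·k!·(d₁d_g)^k = δ_l(X̂, E_δ)·l!·d₁⋯d_g`** (data-free form: g49-#11's existence of the positive
generator on `X` of type `(d₁, …, d_g)` and on the dual torus `X̂` polarised by `E_δ`, of type `(d₁d_g/d_g, …, d₁d_g/d₁)`, Prop. 2.5.1).
[cite: Lange2023AbelianVarietiesComplex, §6.2.4 Prop. 6.2.20, Prop. 6.2.21 (pp. 310–311); §6.3.2 Thm. 6.3.5 (p. 315); §2.5.1 Prop. 2.5.1 (p. 131); §6.2.4 (PDF p. 310 L9–L13)] [cite: Beauville1983FourierChow, §3 Prop. 5 (p. 248)] -/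
theorem IsPolarizationType.exists_thetaDegree_generator_dual (hd : IsPolarizationType Φ η d) (hη : IsRiemannForm Φ η)
    (hk : k ≤ j + 2) (hl : l ≤ j + 2) (hkl : k + l = j + 2) (e : Fin n ≃ ι) (hn : 2 * l + 2 * k = n) (hn' : 2 * k + 2 * l = n) :
    ∃ δ δ' : ℕ, 0 < δ ∧ 0 < δ' ∧
      ((∀ z ∈ integralHodgeClassesIn Φ (2 * k) k, ∃ c : ℤ, poincarePairing Φ e hn (wedgePow (ofRealForm η) l) z = c ∧ (δ : ℤ) ∣ c) ∧
        ∃ z ∈ integralHodgeClassesIn Φ (2 * k) k, poincarePairing Φ e hn (wedgePow (ofRealForm η) l) z = (δ : ℂ)) ∧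
      ((∀ w ∈ integralHodgeClassesIn (dualPeriod Φ) (2 * l) l, ∃ c : ℤ,
          poincarePairing (dualPeriod Φ) e hn'
            (wedgePow (ofRealForm (((d 0 * d (Fin.last (j + 1)) : ℕ) : ℝ) • dualForm Φ hη.1 hη.nondegenerate)) k) w = c ∧ (δ' : ℤ) ∣ c) ∧
        ∃ w ∈ integralHodgeClassesIn (dualPeriod Φ) (2 * l) l,
          poincarePairing (dualPeriod Φ) e hn'
            (wedgePow (ofRealForm (((d 0 * d (Fin.last (j + 1)) : ℕ) : ℝ) • dualForm Φ hη.1 hη.nondegenerate)) k) w = (δ' : ℂ)) ∧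
      δ * (k.factorial * (d 0 * d (Fin.last (j + 1))) ^ k) = δ' * (l.factorial * ∏ i, d i) := by
  obtain ⟨δ, hδpos, hδ⟩ := hd.exists_thetaDegree_generator hη hk hkl e hn
  have hd' := hd.dual Φ hη
  have hη' := hη.dualPolarization Φ hd
  obtain ⟨δ', hδ'pos, hδ'⟩ := hd'.exists_thetaDegree_generator hη' hl (show l + k = j + 2 by omega) e hn'
  exact ⟨δ, δ', hδpos, hδ'pos, hδ, hδ', hd.thetaDegree_generator_mul_eq_dual Φ hη hkl e hn hn' hδ hδ'⟩

end Dual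

/-! ## §3 Back to `X` along `φ_L`: `δ_l·l! ∣ δ_k·k!·d₁⋯d_g`, and `δ_k·k! = δ_l·l!` for a principal polarisation -/

section Pullback

variable {ι : Type*} [Fintype ι] [LinearOrder ι] {E : Type uE} [NormedAddCommGroup E] [NormedSpace ℂ E]
  (Φ : (ι → ℝ) ≃L[ℝ] E) {j n k l : ℕ} {η : E [⋀^Fin 2]→L[ℝ] ℝ} {d : Fin (j + 2) → ℕ}

/-- **`⟨φ_L^*a, φ_L^*b⟩^X_e = d²·⟨a, b⟩^X̂_e`**: pulling back along `φ_L = ρ(ᵗG) : X → X̂` multiplies the cup-product pairing by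
`deg φ_L = det G = (d₁⋯d_g)²` (the same enumeration `e` orienting the lattice basis of `X` and its dual basis of `X̂`; the orientation signs
square away). [cite: Lange2023AbelianVarietiesComplex, §1.4.2 Prop. 1.4.7; §1.7.2 Cor. 1.7.6 (proof); §6.2.4 (p. 310)] [cite: VoisinHodgeI2002, §7.3.2 Rem. 7.29 (PDF p. 150)] -/
theorem IsPolarizationType.poincarePairing_comp_realRep_transposeGram (hd : IsPolarizationType Φ η d) {G : Matrix ι ι ℤ}
    (hG : G.map (Int.cast : ℤ → ℝ) = latticeGram Φ η) (e : Fin n ≃ ι) {a b : ℕ} (h : a + b = n)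
    (x : (E →L⋆[ℂ] ℂ) [⋀^Fin a]→L[ℝ] ℂ) (y : (E →L⋆[ℂ] ℂ) [⋀^Fin b]→L[ℝ] ℂ) :
    poincarePairing Φ e h (x.compContinuousLinearMap (realRep Φ (dualPeriod Φ) G.transpose))
        (y.compContinuousLinearMap (realRep Φ (dualPeriod Φ) G.transpose)) =
      (∏ i, (d i : ℂ)) ^ 2 * poincarePairing (dualPeriod Φ) e h x y := by
  rw [poincarePairing_eq_orientationSign_mul_torusIntegral_wedge Φ e h, ← ContinuousAlternatingMap.wedge_compContinuousLinearMap,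
    torusIntegral_comp_realRep_eq_sign_mul Φ (dualPeriod Φ) G.transpose ((finCongr h).trans e) ((finCongr h).trans e),
    torusIntegral_wedge_eq_orientationSign_mul_poincarePairing (dualPeriod Φ) e h, Matrix.det_submatrix_equiv_self, Matrix.det_transpose,
    hd.det_intGram_eq_sq Φ hG]
  have h1 : (orientationSign Φ ((finCongr h).trans e) : ℂ) * orientationSign Φ ((finCongr h).trans e) = 1 := by
    exact_mod_cast orientationSign_mul_self Φ ((finCongr h).trans e)
  have h2 : (orientationSign (dualPeriod Φ) ((finCongr h).trans e) : ℂ) * orientationSign (dualPeriod Φ) ((finCongr h).trans e) = 1 := by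
    exact_mod_cast orientationSign_mul_self (dualPeriod Φ) ((finCongr h).trans e)
  push_cast
  linear_combination ((orientationSign (dualPeriod Φ) ((finCongr h).trans e) : ℂ) * orientationSign (dualPeriod Φ) ((finCongr h).trans e) *
      (∏ i, (d i : ℂ)) ^ 2 * poincarePairing (dualPeriod Φ) e h x y) * h1 +
    ((∏ i, (d i : ℂ)) ^ 2 * poincarePairing (dualPeriod Φ) e h x y) * h2

/-- **BACK TO `X` ALONG `φ_L`: for every `z ∈ Hdgᵏ(X, ℤ)` there is `w ∈ Hdg^l(X, ℤ)` with `l!·⟨θ^{∧k}, w⟩^X_e = (−1)^k·k!·(d₁⋯d_g)·⟨θ^{∧l}, z⟩^X_e`**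
(`k + l = g`), namely `w = φ_L^*(F z)`: `φ_L = ρ(ᵗG)` is a homomorphism `X → X̂` with `ℂ`-linear analytic representation `φ_H` (Lemma 1.4.5),
so `φ_L^*` maps `Hdg^l(X̂, ℤ) ∋ F z` (Prop. 6.2.20/6.2.21) into `Hdg^l(X, ℤ)`; `φ_L^*((E^*)^{∧k}) = θ^{∧k}` (Lang's transport) and
`⟨φ_L^*a, φ_L^*b⟩^X = d²·⟨a, b⟩^X̂`, so §1 gives the identity.
[cite: Lange2023AbelianVarietiesComplex, §6.2.4 Prop. 6.2.20, Prop. 6.2.21 (pp. 310–311); §6.3.2 Thm. 6.3.5 (p. 315); §1.4.2 Lemma 1.4.5, Prop. 1.4.7; §7.3.3 Exercise (1)] [cite: Lang1982AbelianFunctions, Ch. VII §5 Thm. 5.2 (pp. 119–120)] [cite: Beauville1983FourierChow, §3 Prop. 5 (p. 248)] -/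
theorem IsPolarizationType.exists_mem_integralHodgeClassesIn_factorial_mul_poincarePairing_eq (hd : IsPolarizationType Φ η d)
    (hη : IsRiemannForm Φ η) (hkl : k + l = j + 2) (e : Fin n ≃ ι) (hn : 2 * l + 2 * k = n) (hn' : 2 * k + 2 * l = n)
    {z : E [⋀^Fin (2 * k)]→L[ℝ] ℂ} (hz : z ∈ integralHodgeClassesIn Φ (2 * k) k) :
    ∃ w ∈ integralHodgeClassesIn Φ (2 * l) l,
      (l.factorial : ℂ) * poincarePairing Φ e hn' (wedgePow (ofRealForm η) k) w =
        (-1) ^ k * k.factorial * (∏ i, (d i : ℂ)) * poincarePairing Φ e hn (wedgePow (ofRealForm η) l) z := by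
  classical
  obtain ⟨G, hG⟩ := hη.isNSForm.exists_intMatrix_latticeGram
  -- the analytic representation `φ_H` of `φ_L = ρ(ᵗG)` is `ℂ`-linear
  have hA : ∀ (c : ℂ) (u : E), realRep Φ (dualPeriod Φ) G.transpose (c • u) = c • realRep Φ (dualPeriod Φ) G.transpose u :=
    fun c u ↦ by
      rw [realRep_transposeGram_eq_phiHFun Φ hη.1 hG, realRep_transposeGram_eq_phiHFun Φ hη.1 hG, ← phiHRep_apply Φ hη.1,
        ← phiHRep_apply Φ hη.1, map_smul]
  have hFz : fourierForm Φ e hn' z ∈ integralHodgeClasses (dualPeriod Φ) l := by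
    rw [fourierForm_eq_fourierForm_of_eq Φ e ((finCongr hn').trans e) hn' rfl]
    exact fourierForm_mem_integralHodgeClasses Φ ((finCongr hn').trans e) hz
  refine ⟨(fourierForm Φ e hn' z).compContinuousLinearMap (realRep Φ (dualPeriod Φ) G.transpose),
    comp_realRep_mem_integralHodgeClasses Φ (dualPeriod Φ) G.transpose hA hFz, ?_⟩
  -- `θ^{∧k} = φ_L^*((E^*)^{∧k})`
  have hθ : wedgePow (ofRealForm η) k =
      (wedgePow (ofRealForm (dualForm Φ hη.1 hη.nondegenerate)) k).compContinuousLinearMap (realRep Φ (dualPeriod Φ) G.transpose) := by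
    have h := congrArg Subtype.val (hη.pullbackForms_phiH_wedgePow_dualForm Φ hG hd k)
    rw [coe_pullbackForms_apply] at h
    exact h.symm
  rw [hθ, hd.poincarePairing_comp_realRep_transposeGram Φ hG e hn']
  have h := hd.factorial_mul_poincarePairing_wedgePow_eq_fourier Φ hη hkl e hn hn' z
  linear_combination (-((-1 : ℂ) ^ k * ∏ i, (d i : ℂ))) * h +
    (-((l.factorial : ℂ) * (∏ i, (d i : ℂ)) ^ 2 *
      poincarePairing (dualPeriod Φ) e hn' (wedgePow (ofRealForm (dualForm Φ hη.1 hη.nondegenerate)) k) (fourierForm Φ e hn' z))) *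
      neg_one_pow_mul_self₁₀₃ k

/-- **`δ_l·l! ∣ δ_k·k!·d₁⋯d_g`** for all `k + l = g`: if `δ_k` is a `θ`-degree `⟨θ^{∧l}, z⟩` of some `z ∈ Hdgᵏ(X, ℤ)` and `δ_l` divides every
`θ`-degree `⟨θ^{∧k}, w⟩` of `Hdg^l(X, ℤ)`, then `δ_l·l! ∣ δ_k·k!·d₁⋯d_g` (apply `δ_l ∣ ⟨θ^{∧k}, φ_L^* F z⟩` to the identity above). With the
roles exchanged: `δ_k·k! ∣ δ_l·l!·d₁⋯d_g`.
[cite: Lange2023AbelianVarietiesComplex, §6.2.4 Prop. 6.2.20, Prop. 6.2.21 (pp. 310–311); §6.3.2 Thm. 6.3.5 (p. 315); §1.4.2 Prop. 1.4.7] [cite: Beauville1983FourierChow, §3 Prop. 5 (p. 248)] -/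
theorem IsPolarizationType.thetaDegree_generator_mul_factorial_dvd (hd : IsPolarizationType Φ η d) (hη : IsRiemannForm Φ η)
    (hkl : k + l = j + 2) (e : Fin n ≃ ι) (hn : 2 * l + 2 * k = n) (hn' : 2 * k + 2 * l = n) {δ δ' : ℕ}
    (hδ : ∃ z ∈ integralHodgeClassesIn Φ (2 * k) k, poincarePairing Φ e hn (wedgePow (ofRealForm η) l) z = (δ : ℂ))
    (hδ' : ∀ w ∈ integralHodgeClassesIn Φ (2 * l) l, ∃ c : ℤ, poincarePairing Φ e hn' (wedgePow (ofRealForm η) k) w = c ∧ (δ' : ℤ) ∣ c) :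
    δ' * l.factorial ∣ δ * (k.factorial * ∏ i, d i) := by
  obtain ⟨z, hz, hzδ⟩ := hδ
  obtain ⟨w, hw, hweq⟩ := hd.exists_mem_integralHodgeClassesIn_factorial_mul_poincarePairing_eq Φ hη hkl e hn hn' hz
  obtain ⟨c, hc, hδ'c⟩ := hδ' w hw
  rw [hc, hzδ] at hweq
  have hZ : ((l.factorial : ℕ) : ℤ) * c = (-1) ^ k * ((δ * (k.factorial * ∏ i, d i) : ℕ) : ℤ) := by
    apply Int.cast_injective (α := ℂ)
    push_cast
    linear_combination hweq
  rw [mul_comm δ']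
  exact mul_dvd_of_mul_eq_neg_one_pow_mul₁₀₃ k hδ'c hZ

/-- **PRINCIPAL POLARISATION: `δ_k·k! = δ_l·l!`** (`k + l = g`, type `(1, …, 1)`): the least `θ`-degrees of the integral Hodge classes in
complementary codimensions determine each other — `φ_L : X ⥲ X̂` is an isomorphism of principally polarised tori (Prop. 2.4.12 (b)) and
`φ_L^* ∘ F` maps `Hdgᵏ(X, ℤ)` into `Hdg^l(X, ℤ)` with `l!·⟨θ^{∧k}, φ_L^*F z⟩ = ±k!·⟨θ^{∧l}, z⟩`; both divisibilities of
`thetaDegree_generator_mul_factorial_dvd` with `d₁⋯d_g = 1`. Equivalently `δ_k/l! = δ_l/k!`: the index of the `θ`-degree group of `Hdgᵏ(X, ℤ)` in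
the value group `l!·ℤ = ⟨θ^{∧l}, H^{2k}(X, ℤ)⟩` is symmetric under `k ↔ g − k`.
[cite: Lange2023AbelianVarietiesComplex, §6.2.4 Prop. 6.2.20, Prop. 6.2.21 (pp. 310–311); §6.3.2 Thm. 6.3.5 (p. 315); §2.4.3 Prop. 2.4.12 (b)] [cite: Beauville1983FourierChow, §3 Prop. 5 (p. 248)] [cite: Mukai1981, §2 Thm. 2.2] [cite: BenoistDebarre2023SmoothSubvarietiesJacobians, §1 (p. 3)] -/
theorem IsPolarizationType.thetaDegree_generator_mul_factorial_eq_of_type_one (hd : IsPolarizationType Φ η d) (hη : IsRiemannForm Φ η)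
    (h1 : ∀ i, d i = 1) (hkl : k + l = j + 2) (e : Fin n ≃ ι) (hn : 2 * l + 2 * k = n) (hn' : 2 * k + 2 * l = n) {δ δ' : ℕ}
    (hδ : (∀ z ∈ integralHodgeClassesIn Φ (2 * k) k, ∃ c : ℤ, poincarePairing Φ e hn (wedgePow (ofRealForm η) l) z = c ∧ (δ : ℤ) ∣ c) ∧
      ∃ z ∈ integralHodgeClassesIn Φ (2 * k) k, poincarePairing Φ e hn (wedgePow (ofRealForm η) l) z = (δ : ℂ))
    (hδ' : (∀ w ∈ integralHodgeClassesIn Φ (2 * l) l, ∃ c : ℤ, poincarePairing Φ e hn' (wedgePow (ofRealForm η) k) w = c ∧ (δ' : ℤ) ∣ c) ∧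
      ∃ w ∈ integralHodgeClassesIn Φ (2 * l) l, poincarePairing Φ e hn' (wedgePow (ofRealForm η) k) w = (δ' : ℂ)) :
    δ * k.factorial = δ' * l.factorial := by
  have hprod : ∏ i, d i = 1 := Finset.prod_eq_one fun i _ ↦ h1 i
  have h₁ := hd.thetaDegree_generator_mul_factorial_dvd Φ hη hkl e hn hn' hδ.2 hδ'.1
  have h₂ := hd.thetaDegree_generator_mul_factorial_dvd Φ hη (show l + k = j + 2 by omega) e hn' hn hδ'.2 hδ.1
  rw [hprod, mul_one] at h₁ h₂
  exact Nat.dvd_antisymm h₂ h₁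

/-- **`δ_1 = (g−1)!·δ_{g−1}` on a principally polarised torus**: the least `θ^{∧(g−1)}`-degree of a divisor class (`k = 1`, `l = g − 1`) is
`(g−1)!` times the least `θ`-degree of an integral Hodge curve class (`k = g − 1`, `l = 1`).
[cite: Lange2023AbelianVarietiesComplex, §6.3.2 Thm. 6.3.5 (p. 315); §4.2 Poincaré's formula (PDF p. 204); §6.2.4 Prop. 6.2.20] [cite: BenoistDebarre2023SmoothSubvarietiesJacobians, §1 (p. 3); §3 Prop. 3.3] -/
theorem IsPolarizationType.thetaDegree_generator_one_eq_factorial_mul_of_type_one (hd : IsPolarizationType Φ η d)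
    (hη : IsRiemannForm Φ η) (h1 : ∀ i, d i = 1) (e : Fin n ≃ ι) (hn : 2 * (j + 1) + 2 * 1 = n) (hn' : 2 * 1 + 2 * (j + 1) = n) {δ δ' : ℕ}
    (hδ : (∀ z ∈ integralHodgeClassesIn Φ (2 * 1) 1, ∃ c : ℤ, poincarePairing Φ e hn (wedgePow (ofRealForm η) (j + 1)) z = c ∧ (δ : ℤ) ∣ c) ∧
      ∃ z ∈ integralHodgeClassesIn Φ (2 * 1) 1, poincarePairing Φ e hn (wedgePow (ofRealForm η) (j + 1)) z = (δ : ℂ))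
    (hδ' : (∀ w ∈ integralHodgeClassesIn Φ (2 * (j + 1)) (j + 1), ∃ c : ℤ,
        poincarePairing Φ e hn' (wedgePow (ofRealForm η) 1) w = c ∧ (δ' : ℤ) ∣ c) ∧
      ∃ w ∈ integralHodgeClassesIn Φ (2 * (j + 1)) (j + 1), poincarePairing Φ e hn' (wedgePow (ofRealForm η) 1) w = (δ' : ℂ)) :
    δ = (j + 1).factorial * δ' := by
  have h := hd.thetaDegree_generator_mul_factorial_eq_of_type_one Φ hη h1 (show 1 + (j + 1) = j + 2 by omega) e hn hn' hδ hδ'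
  rw [Nat.factorial_one, mul_one] at h
  rw [h, mul_comm]

/-- **Both generators exist on a principally polarised torus, with `δ_k·k! = δ_l·l!`** (data-free form).
[cite: Lange2023AbelianVarietiesComplex, §6.2.4 Prop. 6.2.20, Prop. 6.2.21 (pp. 310–311); §6.3.2 Thm. 6.3.5 (p. 315); §6.2.4 (PDF p. 310 L9–L13)] [cite: Beauville1983FourierChow, §3 Prop. 5 (p. 248)] -/
theorem IsPolarizationType.exists_thetaDegree_generator_mul_factorial_eq_of_type_one (hd : IsPolarizationType Φ η d)
    (hη : IsRiemannForm Φ η) (h1 : ∀ i, d i = 1) (hk : k ≤ j + 2) (hl : l ≤ j + 2) (hkl : k + l = j + 2) (e : Fin n ≃ ι)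
    (hn : 2 * l + 2 * k = n) (hn' : 2 * k + 2 * l = n) :
    ∃ δ δ' : ℕ, 0 < δ ∧ 0 < δ' ∧
      ((∀ z ∈ integralHodgeClassesIn Φ (2 * k) k, ∃ c : ℤ, poincarePairing Φ e hn (wedgePow (ofRealForm η) l) z = c ∧ (δ : ℤ) ∣ c) ∧
        ∃ z ∈ integralHodgeClassesIn Φ (2 * k) k, poincarePairing Φ e hn (wedgePow (ofRealForm η) l) z = (δ : ℂ)) ∧
      ((∀ w ∈ integralHodgeClassesIn Φ (2 * l) l, ∃ c : ℤ, poincarePairing Φ e hn' (wedgePow (ofRealForm η) k) w = c ∧ (δ' : ℤ) ∣ c) ∧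
        ∃ w ∈ integralHodgeClassesIn Φ (2 * l) l, poincarePairing Φ e hn' (wedgePow (ofRealForm η) k) w = (δ' : ℂ)) ∧
      δ * k.factorial = δ' * l.factorial := by
  obtain ⟨δ, hδpos, hδ⟩ := hd.exists_thetaDegree_generator hη hk hkl e hn
  obtain ⟨δ', hδ'pos, hδ'⟩ := hd.exists_thetaDegree_generator hη hl (show l + k = j + 2 by omega) e hn'
  exact ⟨δ, δ', hδpos, hδ'pos, hδ, hδ', hd.thetaDegree_generator_mul_factorial_eq_of_type_one Φ hη h1 hkl e hn hn' hδ hδ'⟩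

/-- **Principal polarisations of the tree (`IsPrincipalPolarization`, `dim X ≥ 2`): `δ_k·k! = δ_l·l!`** for the `θ`-degree generators of
`Hdgᵏ(X, ℤ)` and `Hdg^l(X, ℤ)`, `k + l = g` (through the type `(1, …, 1)` of a principal polarisation).
[cite: Lange2023AbelianVarietiesComplex, §2.4.3 Prop. 2.4.12 (b); §6.3.2 Thm. 6.3.5 (p. 315); §6.2.4 Prop. 6.2.20] [cite: Beauville1983FourierChow, §3 Prop. 5 (p. 248)] -/
theorem IsPrincipalPolarization.thetaDegree_generator_mul_factorial_eq (hp : IsPrincipalPolarization Φ η) (hg : 4 ≤ Fintype.card ι)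
    (hkl : 2 * (k + l) = Fintype.card ι) (e : Fin n ≃ ι) (hn : 2 * l + 2 * k = n) (hn' : 2 * k + 2 * l = n) {δ δ' : ℕ}
    (hδ : (∀ z ∈ integralHodgeClassesIn Φ (2 * k) k, ∃ c : ℤ, poincarePairing Φ e hn (wedgePow (ofRealForm η) l) z = c ∧ (δ : ℤ) ∣ c) ∧
      ∃ z ∈ integralHodgeClassesIn Φ (2 * k) k, poincarePairing Φ e hn (wedgePow (ofRealForm η) l) z = (δ : ℂ))
    (hδ' : (∀ w ∈ integralHodgeClassesIn Φ (2 * l) l, ∃ c : ℤ, poincarePairing Φ e hn' (wedgePow (ofRealForm η) k) w = c ∧ (δ' : ℤ) ∣ c) ∧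
      ∃ w ∈ integralHodgeClassesIn Φ (2 * l) l, poincarePairing Φ e hn' (wedgePow (ofRealForm η) k) w = (δ' : ℂ)) :
    δ * k.factorial = δ' * l.factorial := by
  obtain ⟨g, d', hd', h1⟩ := hp.exists_type_eq_one
  have hcard := hd'.card_eq
  obtain ⟨j, rfl⟩ : ∃ j, g = j + 2 := ⟨g - 2, by omega⟩
  exact hd'.thetaDegree_generator_mul_factorial_eq_of_type_one Φ hp.isRiemannForm h1 (by omega) e hn hn' hδ hδ'

end Pullback

end Literature.Geometry.Kaehler.ComplexTorus

end
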